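import Summits.CriticalPhenomena.PercolationContinuityZ3.Theorems.FK.DomainMarkovForcedWiringLimit
import HarnessLib

/-!
# FK-continuity transplant, FO-10 (domain-Markov toolkit, seat A): seeded exploration steps under `φ^b_{p,q}` —
# the history-forced-wiring sandwich summed over the atoms of a history

Cell `fk-continuity` (bschramm), row FO-10a; support file for the FK-continuity transplant
(`--supports stmt-CriticalPhenomena-4575`); builds on p205010 (kernel theorem, internal audit signed; external
expert review pending).  Pure proofs; no definitions, no named facts, no sorries.  Fourth file of the chain
`DomainMarkovForcedWiring` → `…Sum` → `…Limit` → this file.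

## What is proved

The form in which one step of a Kozma–Nitzan exploration is bounded under the infinite-volume random-cluster
measure (Kozma–Nitzan 2024, §4 p. 25, clause (4) of an exploration process; cell SCOPING.md §3.6 C1): the history up
to the current step is a finite disjoint union of ATOMS `H i` (one per revealed pattern), each determined by its
revealed pair set `T i`; atom `i` comes with its fresh edge set `F i ⊆ E_{Λ i}` (copy `R i` on the piece `Λ i`), a
SEED `W i ⊆ Λ i` that the atom exhibits as joined by open revealed edges (`H i ⊆ {x ↔ y}`, `x, y ∈ W i`), and a
fresh increasing target event `A i` (resp. decreasing failure event `D i`) determined by `F i`.  If the seeded region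
laws are bounded uniformly over the atoms, the bound transfers to the whole step:

* `IsBoxLimit.mul_real_biUnion_le_of_openConn` — `c ≤ φ^{W_i}_{⟨R_i⟩,p,q}(A_i)` for all `i` gives
  `c · P(⋃ H_i) ≤ P(⋃ (A_i ∩ H_i))` ("the seeded trial succeeds with conditional probability ≥ c");
* `IsBoxLimit.real_biUnion_le_mul_of_openConn` — `φ^{W_i}_{⟨R_i⟩,p,q}(D_i) ≤ C` for all `i` gives
  `P(⋃ (D_i ∩ H_i)) ≤ C · P(⋃ H_i)` ("the seeded trial fails with conditional probability ≤ C"),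

for every box limit `P` (`IsBoxLimit d b p q P`, `p ∈ [0,1]`, `q ≥ 1`).  Iterating the second bound along the
trials is `measureReal_le_pow_mul_of_succ_le` (`DomainMarkovToolkit.lean`).  Without seeds (`W i = ∅`) these are
the atom-summed free/wired sandwiches of `DomainMarkovToolkit.lean` over FO-06a's `FKGibbs`.

## References

* G. Grimmett, *The Random-Cluster Model*, Springer 2006: Lemma (4.13) p. 70, Lemma (4.14)(b) p. 71. [Grimmett2006]
* G. Kozma, S. Nitzan, arXiv:2401.12397 (2024), §4 p. 25 (exploration processes, clause (4)). [KozmaNitzan2024]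
-/

noncomputable section

open MeasureTheory Set Filter
open scoped Topology ENNReal

namespace Summit.CriticalPhenomena.PercolationContinuityZ3.Theorems.FK

open Literature.Probability.Percolation Literature.Probability.LatticeModels

namespace IsBoxLimit

open SimpleGraph

variable {d : ℕ} {b : Bool} {p q : ℝ} {P : Measure (BondConfig (Site d))} {ι : Type*}

/-- **Seeded exploration step, success side**: with atoms `H i` (pairwise disjoint, determined by `T i`), fresh
edges `F i ⊆ E_{Λ i}` (copies `R i`, `T i` disjoint from `F i`), seeds `W i ⊆ Λ i` joined by every `ω ∈ H i`, and
increasing targets `A i` determined by `F i`: if `c ≤ φ^{W_i}_{⟨R_i⟩,p,q}(A_i)` for every atom then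
`c · P(⋃ H_i) ≤ P(⋃ (A_i ∩ H_i))`. [cite: Grimmett2006, Lemma (4.13) and Lemma (4.14)(b)] -/
theorem mul_real_biUnion_le_of_openConn (hP : IsBoxLimit d b p q P) (hp : p ∈ Set.Icc (0 : ℝ) 1) (hq : 1 ≤ q)
    (s : Finset ι) (Λ : ι → Finset (Site d)) (F : ι → Finset (Sym2 (Site d))) (R : ∀ i, Finset (Sym2 ↥(Λ i)))
    (W : ∀ i, Set ↥(Λ i)) (T : ι → Finset (Sym2 (Site d))) (A H : ι → Set (BondConfig (Site d)))
    (hF : ∀ i ∈ s, (↑(F i) : Set (Sym2 (Site d))) ⊆ ↑(edgesIn (zdGraph d) (Λ i)))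
    (hFR : ∀ i ∈ s, ∀ e : Sym2 ↥(Λ i), e ∈ R i ↔ Sym2.map Subtype.val e ∈ F i)
    (hA : ∀ i ∈ s, IsUpperSet (A i)) (hAF : ∀ i ∈ s, DeterminedBy (A i) ↑(F i))
    (hT : ∀ i ∈ s, Disjoint (↑(T i) : Set (Sym2 (Site d))) ↑(F i)) (hH : ∀ i ∈ s, DeterminedBy (H i) ↑(T i))
    (hHW : ∀ i ∈ s, ∀ ω ∈ H i, ∀ x ∈ W i, ∀ y ∈ W i, ω ∈ openConn (x : Site d) (y : Site d))
    (hdisj : (↑s : Set ι).PairwiseDisjoint H) {c : ℝ}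
    (hc : ∀ i ∈ s, c ≤ (rcMeasure (fromEdgeSet (↑(R i) : Set (Sym2 ↥(Λ i)))) p q (W i)).real
      (liftEdges (Λ i) ⁻¹' A i)) :
    c * P.real (⋃ i ∈ s, H i) ≤ P.real (⋃ i ∈ s, (A i ∩ H i)) := by
  haveI := hP.isProbabilityMeasure
  have hHm : ∀ i ∈ s, MeasurableSet (H i) := fun i hi => (hH i hi).measurableSet_of_finset
  have hAHm : ∀ i ∈ s, MeasurableSet (A i ∩ H i) := fun i hi =>
    ((hAF i hi).measurableSet_of_finset).inter (hHm i hi)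
  have hdisj' : (↑s : Set ι).PairwiseDisjoint fun i => A i ∩ H i :=
    hdisj.mono fun i => Set.inter_subset_right
  rw [measureReal_biUnion_finset hdisj hHm, measureReal_biUnion_finset hdisj' hAHm, Finset.mul_sum]
  refine Finset.sum_le_sum fun i hi => ?_
  exact (mul_le_mul_of_nonneg_right (hc i hi) measureReal_nonneg).trans
    (hP.fromEdgeSet_real_mul_le_of_openConn hp hq (Λ i) (hF i hi) (hFR i hi) (W i) (T i) (hA i hi) (hAF i hi)
      (hT i hi) (hH i hi) (hHW i hi))

/-- **Seeded exploration step, failure side**: with the same atoms and seeds and DECREASING failure events `D i`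
determined by `F i`: if `φ^{W_i}_{⟨R_i⟩,p,q}(D_i) ≤ C` for every atom then `P(⋃ (D_i ∩ H_i)) ≤ C · P(⋃ H_i)` — the
trial fails with conditional probability at most `C` given the history, whatever else the history says.
[cite: Grimmett2006, Lemma (4.13) and Lemma (4.14)(b)] -/
theorem real_biUnion_le_mul_of_openConn (hP : IsBoxLimit d b p q P) (hp : p ∈ Set.Icc (0 : ℝ) 1) (hq : 1 ≤ q)
    (s : Finset ι) (Λ : ι → Finset (Site d)) (F : ι → Finset (Sym2 (Site d))) (R : ∀ i, Finset (Sym2 ↥(Λ i)))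
    (W : ∀ i, Set ↥(Λ i)) (T : ι → Finset (Sym2 (Site d))) (D H : ι → Set (BondConfig (Site d)))
    (hF : ∀ i ∈ s, (↑(F i) : Set (Sym2 (Site d))) ⊆ ↑(edgesIn (zdGraph d) (Λ i)))
    (hFR : ∀ i ∈ s, ∀ e : Sym2 ↥(Λ i), e ∈ R i ↔ Sym2.map Subtype.val e ∈ F i)
    (hD : ∀ i ∈ s, IsLowerSet (D i)) (hDF : ∀ i ∈ s, DeterminedBy (D i) ↑(F i))
    (hT : ∀ i ∈ s, Disjoint (↑(T i) : Set (Sym2 (Site d))) ↑(F i)) (hH : ∀ i ∈ s, DeterminedBy (H i) ↑(T i))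
    (hHW : ∀ i ∈ s, ∀ ω ∈ H i, ∀ x ∈ W i, ∀ y ∈ W i, ω ∈ openConn (x : Site d) (y : Site d))
    (hdisj : (↑s : Set ι).PairwiseDisjoint H) {C : ℝ}
    (hC : ∀ i ∈ s, (rcMeasure (fromEdgeSet (↑(R i) : Set (Sym2 ↥(Λ i)))) p q (W i)).real
      (liftEdges (Λ i) ⁻¹' D i) ≤ C) :
    P.real (⋃ i ∈ s, (D i ∩ H i)) ≤ C * P.real (⋃ i ∈ s, H i) := by
  haveI := hP.isProbabilityMeasure
  have hHm : ∀ i ∈ s, MeasurableSet (H i) := fun i hi => (hH i hi).measurableSet_of_finset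
  have hDHm : ∀ i ∈ s, MeasurableSet (D i ∩ H i) := fun i hi =>
    ((hDF i hi).measurableSet_of_finset).inter (hHm i hi)
  have hdisj' : (↑s : Set ι).PairwiseDisjoint fun i => D i ∩ H i :=
    hdisj.mono fun i => Set.inter_subset_right
  rw [measureReal_biUnion_finset hdisj hHm, measureReal_biUnion_finset hdisj' hDHm, Finset.mul_sum]
  refine Finset.sum_le_sum fun i hi => ?_
  exact (hP.real_inter_le_fromEdgeSet_real_mul_of_openConn hp hq (Λ i) (hF i hi) (hFR i hi) (W i) (T i) (hD i hi)
    (hDF i hi) (hT i hi) (hH i hi) (hHW i hi)).trans (mul_le_mul_of_nonneg_right (hC i hi) measureReal_nonneg)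

end IsBoxLimit

end Summit.CriticalPhenomena.PercolationContinuityZ3.Theorems.FK

end
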